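import Literature.Probability.Percolation.FourArmGarbanTwoArms
import HarnessLib

/-!
# Garban's multi-scale four-arm bound: monotonicity of the cluster-form arm events in the radii

Topic `Literature/Probability/Percolation`; proof-only companion of `FourArmGarban.lean` (the named
fact `Garban2011_fourArm_multiscale`: C. Garban, Appendix B of O. Schramm, S. Smirnov, *On the
scaling limits of planar percolation*, Ann. Probab. 39 (2011), Lemma B.1; restated as J. van den
Berg, P. Nolin, Progr. Probab. 77 (2020), Lemma 8). No definition, no named fact.

Every proof of the multi-scale bound (Garban's, loc. cit.; van den Berg–Nolin's variant through
the number of crossing clusters, §5) produces the estimate `π₄(m,n) ≲ (m/n)^{1+ε}` only for radii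
of a special form (squares `Q_j` of side `r` inside `(1/3)Q`, annuli `A_{n,2n}`, ...), and then
invokes two elementary facts, used tacitly in both sources ("changing the radii by bounded
factors", SS11 App. B, first paragraph of the proof; "using also that `π₄` is decreasing", vdBN
§5.2, last sentence):

* **monotonicity of the arm events in the radii** — shrinking the annulus `A_{m,n}` from either
  side preserves the four-arm and the two-arm events. For the cluster-form events of
  `FourArmGarban.lean` this is proved here on lattice configurations (`P_p`-a.s.):
  `fourArmTwoClusters m n ⊆ fourArmTwoClusters m' n'` and `twoArmOpenDual m n ⊆ twoArmOpenDual m' n'`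
  for `m ≤ m' ≤ n' ≤ n` (`mem_fourArmTwoClusters_mono`, `mem_twoArmOpenDual_mono`), by first-exit /
  last-entry surgery of the open crossings (`exists_prefix_exit`, `FourArmGarbanTwoArms.lean`) and
  monotonicity of `openConnIn` in the vertex set; whence
  `π₄(m,n) ≤ π₄(m',n')`, `π₂(m,n) ≤ π₂(m',n')` (`real_fourArmTwoClusters_mono`,
  `real_twoArmOpenDual_mono`, every `p`);
* **bounded ratios are free** — a bound `f(m,n) ≤ c (m/n)^κ` valid for `n ≥ K m` extends to all
  `1 ≤ m ≤ n` with the constant `max c K^κ` when `f ≤ 1` (`ratio_bound_of_large_ratio`).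

## References

* O. Schramm, S. Smirnov (appendix by C. Garban), Ann. Probab. 39 (2011), Appendix B, proof of
  Lemma B.1, first paragraph [SchrammSmirnov2011].
* J. van den Berg, P. Nolin, *On the four-arm exponent for 2D percolation at criticality*,
  Progr. Probab. 77 (2020), §2 ("monotonicity" of `π_k(n₁,n₂)` in `n₁`, `n₂`), §5.2 (last
  sentence) [VandenbergNolin2020].

Tree: `siteSphere`, `sqAnnulus`, `sqAnnulusOpenCrossing`, `openCircuitInAnnulus`, `twoArmOpenDual`,
`fourArmTwoClusters` (`FourArmGarban.lean`), `one_le_of_mem_siteSphere` (`FourArmGarbanProofs.lean`),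
`exists_prefix_exit` (`FourArmGarbanTwoArms.lean`), `exists_walk_of_mem_openConnIn`,
`mem_openConnIn_of_walk`, `mem_openConnIn_of_mem_support`, `openConnIn_comm`, `openConnIn_refl`,
`PlanarDuality.openConnIn_trans` (`PlanarDuality.lean`), `box_mono`, `mem_box`, `mem_annulus`
(`ThermodynamicLimit.lean`). Mathlib: `ProbabilityTheory.setBernoulli_ae_subset`,
`Real.rpow_le_rpow_left_iff`, `Real.rpow_natCast`.
-/

noncomputable section

namespace Literature.Probability.Percolation

open _root_.MeasureTheory Set LatticeModels

/-! ### Elementary geometry of boxes, spheres and annuli -/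

/-- A neighbour of a site of `B(k)` lies in `B(k+1)` (`d = 2`). [folklore] -/
private theorem mem_box_succ_of_adj₂ {k : ℕ} {x z : Site 2} (hx : x ∈ box 2 k)
    (h : (zdGraph 2).Adj x z) : z ∈ box 2 (k + 1) := by
  rw [mem_box] at hx ⊢
  obtain ⟨j, hj | hj⟩ := (zdGraph_adj_iff x z).1 h
  · intro i
    have h2 := hx i
    have h3 : z i = x i + (Pi.single j (1 : ℤ) : Site 2) i := by rw [hj]; rfl
    rw [Pi.single_apply] at h3
    push_cast
    split_ifs at h3 <;> omega
  · intro i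
    have h2 := hx i
    have h3 : x i = z i + (Pi.single j (1 : ℤ) : Site 2) i := by rw [hj]; rfl
    rw [Pi.single_apply] at h3
    push_cast
    split_ifs at h3 <;> omega

/-- The annulus `A_{m,n}` shrinks when `m` grows and `n` decreases. [folklore] -/
theorem sqAnnulus_mono {m m' n' n : ℕ} (hm : m ≤ m') (hn : n' ≤ n) : sqAnnulus m' n' ⊆ sqAnnulus m n := by
  intro x hx
  simp only [sqAnnulus, Finset.mem_coe, mem_annulus] at hx ⊢
  exact ⟨box_mono 2 hn hx.1, fun h => hx.2 (box_mono 2 (by omega) h)⟩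

/-- A site of the sphere `‖x‖_∞ = m` lies in the annulus `A_{m,n}` for `m ≤ n`. [folklore] -/
theorem mem_sqAnnulus_of_mem_siteSphere {m n : ℕ} (hmn : m ≤ n) {x : Site 2} (hx : x ∈ siteSphere m) :
    x ∈ sqAnnulus m n := by
  simp only [siteSphere, Finset.mem_sdiff] at hx
  simp only [sqAnnulus, Finset.mem_coe, mem_annulus]
  exact ⟨box_mono 2 hmn hx.1, hx.2⟩

/-- `{x ↔ y in S}` is monotone in the vertex set `S`. [folklore] -/
private theorem openConnIn_mono₂ {V : Type*} {S S' : Set V} (h : S ⊆ S') {x y : V} {ω : BondConfig V}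
    (hxy : ω ∈ openConnIn S x y) : ω ∈ openConnIn S' x y := by
  obtain ⟨hx, hy, hr⟩ := hxy
  exact ⟨h hx, h hy, hr.map (SimpleGraph.induceHomOfLE (G := openGraph ω) h).toHom⟩

/-! ### Surgery of open crossings: shrinking the outer radius -/

/-- **Shrinking the outer radius.** On a lattice configuration, an open crossing of `A_{m,n}` from
a site `x` with `‖x‖_∞ = m` to `‖·‖_∞ = n` contains an open crossing of `A_{m,n'}` from the same
`x` to `‖·‖_∞ = n'`, for every `m ≤ n' ≤ n` (stop at the first visit to `‖·‖_∞ = n'`).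
(van den Berg–Nolin 2020, §2, monotonicity in `n₂`.) [folklore] -/
theorem exists_openConnIn_sqAnnulus_of_le_right {m n' n : ℕ} (hmn' : m ≤ n') (hn'n : n' ≤ n)
    {ω : BondConfig (Site 2)} (hω : ω ⊆ (zdGraph 2).edgeSet) {x y : Site 2}
    (hx : x ∈ siteSphere m) (hy : y ∈ siteSphere n) (h : ω ∈ openConnIn (sqAnnulus m n) x y) :
    ∃ y' ∈ siteSphere n', ω ∈ openConnIn (sqAnnulus m n') x y' := by
  have hm : 1 ≤ m := one_le_of_mem_siteSphere hx
  obtain ⟨p, hps, hpe⟩ := exists_walk_of_mem_openConnIn hω h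
  by_cases hxb : x ∈ box 2 (n' - 1)
  · -- first exit from `B(n'-1)`
    have hxA : x ∈ (↑(box 2 (n' - 1)) : Set (Site 2)) := Finset.mem_coe.2 hxb
    have hyA : y ∉ (↑(box 2 (n' - 1)) : Set (Site 2)) := by
      simp only [siteSphere, Finset.mem_sdiff] at hy
      exact fun h' => hy.2 (box_mono 2 (by omega) (Finset.mem_coe.1 h'))
    obtain ⟨x', z, q₁, hxz, hz, hA, hS, hE, hlast⟩ := exists_prefix_exit p hxA hyA
    have hzb : z ∈ box 2 n' := by
      have := mem_box_succ_of_adj₂ (Finset.mem_coe.1 (hA x' q₁.end_mem_support)) hxz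
      rwa [Nat.sub_add_cancel (hm.trans hmn')] at this
    have hzs : z ∈ siteSphere n' := Finset.mem_sdiff.2 ⟨hzb, fun h' => hz (Finset.mem_coe.2 h')⟩
    have hzp : z ∈ p.support := p.snd_mem_support_of_mem_edges hlast
    refine ⟨z, hzs, mem_openConnIn_of_walk (q₁.concat hxz) (fun v hv => ?_) (fun e he => ?_)⟩
    · rw [SimpleGraph.Walk.support_concat, List.mem_append, List.mem_singleton] at hv
      rcases hv with hv | rfl
      · have h1 := hps v (hS v hv)
        simp only [sqAnnulus, Finset.mem_coe, mem_annulus] at h1 ⊢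
        exact ⟨box_mono 2 (Nat.sub_le n' 1) (Finset.mem_coe.1 (hA v hv)), h1.2⟩
      · have h1 := hps _ hzp
        simp only [sqAnnulus, Finset.mem_coe, mem_annulus] at h1 ⊢
        exact ⟨hzb, h1.2⟩
    · rw [SimpleGraph.Walk.edges_concat, List.concat_eq_append, List.mem_append,
        List.mem_singleton] at he
      rcases he with he | rfl
      · exact hpe e (hE e he)
      · exact hpe _ hlast
  · -- `x` already lies on the sphere `‖·‖_∞ = n'`
    have hxs : x ∈ siteSphere n' := by
      simp only [siteSphere, Finset.mem_sdiff] at hx ⊢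
      exact ⟨box_mono 2 hmn' hx.1, hxb⟩
    exact ⟨x, hxs, openConnIn_refl (mem_sqAnnulus_of_mem_siteSphere hmn' hx)⟩

/-! ### Surgery of open crossings: raising the inner radius -/

/-- **Raising the inner radius.** On a lattice configuration, an open crossing of `A_{m,n}` from
`‖x‖_∞ = m` to `‖y‖_∞ = n` contains an open crossing of `A_{m',n}` from some `x'` with
`‖x'‖_∞ = m'` to the same `y`, for every `m ≤ m' ≤ n` (keep the part after the last visit to
`‖·‖_∞ ≤ m' - 1`); moreover `x'` lies on the original crossing, so `x ↔ x'` in `A_{m,n}`.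
(van den Berg–Nolin 2020, §2, monotonicity in `n₁`.) [folklore] -/
theorem exists_openConnIn_sqAnnulus_of_le_left {m m' n : ℕ} (hmm' : m ≤ m') (hm'n : m' ≤ n)
    {ω : BondConfig (Site 2)} (hω : ω ⊆ (zdGraph 2).edgeSet) {x y : Site 2}
    (hx : x ∈ siteSphere m) (hy : y ∈ siteSphere n) (h : ω ∈ openConnIn (sqAnnulus m n) x y) :
    ∃ x' ∈ siteSphere m', ω ∈ openConnIn (sqAnnulus m' n) x' y ∧
      ω ∈ openConnIn (sqAnnulus m n) x x' := by
  have hm : 1 ≤ m := one_le_of_mem_siteSphere hx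
  rcases Nat.eq_or_lt_of_le hmm' with rfl | hlt
  · exact ⟨x, hx, h, openConnIn_refl (mem_sqAnnulus_of_mem_siteSphere hm'n hx)⟩
  obtain ⟨p, hps, hpe⟩ := exists_walk_of_mem_openConnIn hω h
  -- last entry into `B(m'-1)`: first exit of the reversed walk from the complement
  have hyA : y ∈ ({v | v ∉ box 2 (m' - 1)} : Set (Site 2)) := by
    simp only [siteSphere, Finset.mem_sdiff] at hy
    exact fun h' => hy.2 (box_mono 2 (by omega) h')
  have hxA : x ∉ ({v | v ∉ box 2 (m' - 1)} : Set (Site 2)) := by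
    simp only [siteSphere, Finset.mem_sdiff] at hx
    exact fun h' => h' (box_mono 2 (by omega) hx.1)
  obtain ⟨x', z', q₃, hx'z', hz', hA', hS', hE', -⟩ :=
    exists_prefix_exit (A := {v | v ∉ box 2 (m' - 1)}) p.reverse hyA hxA
  have hz'box : z' ∈ box 2 (m' - 1) := not_not.1 hz'
  have hx'a : x' ∈ box 2 m' := by
    have := mem_box_succ_of_adj₂ hz'box hx'z'.symm
    rwa [Nat.sub_add_cancel (hm.trans hmm')] at this
  have hx's : x' ∈ siteSphere m' := Finset.mem_sdiff.2 ⟨hx'a, hA' x' q₃.end_mem_support⟩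
  have hx'p : x' ∈ p.support := by
    have := hS' x' q₃.end_mem_support
    rwa [SimpleGraph.Walk.support_reverse, List.mem_reverse] at this
  refine ⟨x', hx's, ?_, mem_openConnIn_of_mem_support p hps hpe hx'p⟩
  rw [openConnIn_comm]
  refine mem_openConnIn_of_walk q₃ (fun v hv => ?_) (fun e he => ?_)
  · have h1 : v ∈ p.support := by
      have := hS' v hv
      rwa [SimpleGraph.Walk.support_reverse, List.mem_reverse] at this
    have h2 := hps v h1
    simp only [sqAnnulus, Finset.mem_coe, mem_annulus] at h2 ⊢
    exact ⟨h2.1, hA' v hv⟩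
  · have := hE' e he
    rw [SimpleGraph.Walk.edges_reverse, List.mem_reverse] at this
    exact hpe e this

/-! ### Monotonicity of the four-arm event -/

/-- **The four-arm event is monotone under shrinking the annulus** (lattice configurations): for
`m ≤ m' ≤ n' ≤ n`, two open crossings of `A_{m,n}` in distinct open clusters of `A_{m,n}` restrict
to two open crossings of `A_{m',n'}` whose inner endpoints are not joined in `A_{m',n'} ⊆ A_{m,n}`
(a junction in the smaller annulus, together with the discarded initial pieces of the two
crossings, would join `x₁` to `x₂` in `A_{m,n}`). (van den Berg–Nolin 2020, §2: "`π_k(n₁,n₂)` is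
non-increasing in `n₂` and non-decreasing in `n₁`", for the cluster form of `π₄`.) [cite: VandenbergNolin2020, §2 (monotonicity of arm events in the radii)] -/
theorem mem_fourArmTwoClusters_mono {m m' n' n : ℕ} (hmm' : m ≤ m') (hm'n' : m' ≤ n') (hn'n : n' ≤ n)
    {ω : BondConfig (Site 2)} (hω : ω ⊆ (zdGraph 2).edgeSet) (h : ω ∈ fourArmTwoClusters m n) :
    ω ∈ fourArmTwoClusters m' n' := by
  obtain ⟨x₁, hx₁, x₂, hx₂, y₁, hy₁, y₂, hy₂, h₁, h₂, h₁₂⟩ := h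
  -- raise the inner radius
  obtain ⟨x₁', hx₁', g₁, j₁⟩ := exists_openConnIn_sqAnnulus_of_le_left hmm' (hm'n'.trans hn'n) hω hx₁ hy₁ h₁
  obtain ⟨x₂', hx₂', g₂, j₂⟩ := exists_openConnIn_sqAnnulus_of_le_left hmm' (hm'n'.trans hn'n) hω hx₂ hy₂ h₂
  -- shrink the outer radius
  obtain ⟨y₁', hy₁', k₁⟩ := exists_openConnIn_sqAnnulus_of_le_right hm'n' hn'n hω hx₁' hy₁ g₁
  obtain ⟨y₂', hy₂', k₂⟩ := exists_openConnIn_sqAnnulus_of_le_right hm'n' hn'n hω hx₂' hy₂ g₂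
  refine ⟨x₁', hx₁', x₂', hx₂', y₁', hy₁', y₂', hy₂', k₁, k₂, fun hc => h₁₂ ?_⟩
  have hc' : ω ∈ openConnIn (sqAnnulus m n) x₁' x₂' := openConnIn_mono₂ (sqAnnulus_mono hmm' hn'n) hc
  rw [openConnIn_comm] at j₂
  exact PlanarDuality.openConnIn_trans (PlanarDuality.openConnIn_trans j₁ hc') j₂

/-- **`π₄(m,n) ≤ π₄(m',n')` for `m ≤ m' ≤ n' ≤ n`** (every edge density `p`; lattice
configurations carry `P_p`). [cite: VandenbergNolin2020, §2 (monotonicity of arm events in the radii)] -/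
theorem real_fourArmTwoClusters_mono (p : unitInterval) {m m' n' n : ℕ} (hmm' : m ≤ m') (hm'n' : m' ≤ n')
    (hn'n : n' ≤ n) :
    (bondPercolation (zdGraph 2) p).real (fourArmTwoClusters m n) ≤
      (bondPercolation (zdGraph 2) p).real (fourArmTwoClusters m' n') := by
  refine ENNReal.toReal_mono (measure_ne_top _ _) (measure_mono_ae ?_)
  have hae : ∀ᵐ ω ∂(bondPercolation (zdGraph 2) p), ω ⊆ (zdGraph 2).edgeSet :=
    ProbabilityTheory.setBernoulli_ae_subset
  filter_upwards [hae] with ω hω h4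
  exact mem_fourArmTwoClusters_mono hmm' hm'n' hn'n hω h4

/-! ### Monotonicity of the one-arm and two-arm events -/

/-- Open circuits of a smaller annulus are open circuits of a bigger one. [folklore] -/
theorem openCircuitInAnnulus_mono {m m' n' n : ℕ} (hmm' : m ≤ m') (hn'n : n' ≤ n) :
    openCircuitInAnnulus m' n' ⊆ openCircuitInAnnulus m n := by
  rintro ω ⟨u, w, hc, hs, ho, he⟩
  exact ⟨u, w, hc, fun x hx => sqAnnulus_mono hmm' hn'n (hs x hx), ho, he⟩

/-- **The one-arm (crossing) event is monotone under shrinking the annulus** (lattice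
configurations). [cite: VandenbergNolin2020, §2 (monotonicity of arm events in the radii)] -/
theorem mem_sqAnnulusOpenCrossing_mono {m m' n' n : ℕ} (hmm' : m ≤ m') (hm'n' : m' ≤ n') (hn'n : n' ≤ n)
    {ω : BondConfig (Site 2)} (hω : ω ⊆ (zdGraph 2).edgeSet) (h : ω ∈ sqAnnulusOpenCrossing m n) :
    ω ∈ sqAnnulusOpenCrossing m' n' := by
  obtain ⟨x, hx, y, hy, hxy⟩ := h
  obtain ⟨x', hx', g, -⟩ := exists_openConnIn_sqAnnulus_of_le_left hmm' (hm'n'.trans hn'n) hω hx hy hxy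
  obtain ⟨y', hy', k⟩ := exists_openConnIn_sqAnnulus_of_le_right hm'n' hn'n hω hx' hy g
  exact ⟨x', hx', y', hy', k⟩

/-- **The two-arm event is monotone under shrinking the annulus** (lattice configurations): the
open crossing restricts, and an open circuit of the smaller annulus around the origin would be one
of the bigger annulus. [cite: VandenbergNolin2020, §2 (monotonicity of arm events in the radii)] -/
theorem mem_twoArmOpenDual_mono {m m' n' n : ℕ} (hmm' : m ≤ m') (hm'n' : m' ≤ n') (hn'n : n' ≤ n)
    {ω : BondConfig (Site 2)} (hω : ω ⊆ (zdGraph 2).edgeSet) (h : ω ∈ twoArmOpenDual m n) :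
    ω ∈ twoArmOpenDual m' n' :=
  ⟨mem_sqAnnulusOpenCrossing_mono hmm' hm'n' hn'n hω h.1,
    fun hc => h.2 (openCircuitInAnnulus_mono hmm' hn'n hc)⟩

/-- **`π₂(m,n) ≤ π₂(m',n')` for `m ≤ m' ≤ n' ≤ n`** (every edge density `p`). [cite: VandenbergNolin2020, §2 (monotonicity of arm events in the radii)] -/
theorem real_twoArmOpenDual_mono (p : unitInterval) {m m' n' n : ℕ} (hmm' : m ≤ m') (hm'n' : m' ≤ n')
    (hn'n : n' ≤ n) :
    (bondPercolation (zdGraph 2) p).real (twoArmOpenDual m n) ≤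
      (bondPercolation (zdGraph 2) p).real (twoArmOpenDual m' n') := by
  refine ENNReal.toReal_mono (measure_ne_top _ _) (measure_mono_ae ?_)
  have hae : ∀ᵐ ω ∂(bondPercolation (zdGraph 2) p), ω ⊆ (zdGraph 2).edgeSet :=
    ProbabilityTheory.setBernoulli_ae_subset
  filter_upwards [hae] with ω hω h2
  exact mem_twoArmOpenDual_mono hmm' hm'n' hn'n hω h2

/-- **`π₁(m,n) ≤ π₁(m',n')` for `m ≤ m' ≤ n' ≤ n`** (every edge density `p`). [cite: VandenbergNolin2020, §2 (monotonicity of arm events in the radii)] -/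
theorem real_sqAnnulusOpenCrossing_mono (p : unitInterval) {m m' n' n : ℕ} (hmm' : m ≤ m')
    (hm'n' : m' ≤ n') (hn'n : n' ≤ n) :
    (bondPercolation (zdGraph 2) p).real (sqAnnulusOpenCrossing m n) ≤
      (bondPercolation (zdGraph 2) p).real (sqAnnulusOpenCrossing m' n') := by
  refine ENNReal.toReal_mono (measure_ne_top _ _) (measure_mono_ae ?_)
  have hae : ∀ᵐ ω ∂(bondPercolation (zdGraph 2) p), ω ⊆ (zdGraph 2).edgeSet :=
    ProbabilityTheory.setBernoulli_ae_subset
  filter_upwards [hae] with ω hω h1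
  exact mem_sqAnnulusOpenCrossing_mono hmm' hm'n' hn'n hω h1

/-! ### Bounded ratios are free -/

/-- **Bounded ratios are free.** If a quantity `f(m,n) ≤ 1` satisfies `f(m,n) ≤ c (m/n)^κ`
whenever `1 ≤ m` and `K m ≤ n` (`K ≥ 1`, `κ ≥ 0`), then `f(m,n) ≤ max c K^κ · (m/n)^κ` for all
`1 ≤ m ≤ n`: in the remaining range `n < K m` one has `(m/n)^κ ≥ K^{-κ}`. (The tacit reduction
"changing the radii by bounded factors" of SS11, App. B, proof of Lemma B.1, first paragraph.)
[cite: SchrammSmirnov2011, Appendix B, proof of Lemma B.1 (first paragraph)] -/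
theorem ratio_bound_of_large_ratio {f : ℕ → ℕ → ℝ} {κ c K : ℝ} (hκ : 0 ≤ κ) (hK : 1 ≤ K)
    (hf1 : ∀ m n, f m n ≤ 1)
    (hb : ∀ m n : ℕ, 1 ≤ m → K * m ≤ n → f m n ≤ c * ((m : ℝ) / n) ^ κ) :
    ∀ m n : ℕ, 1 ≤ m → m ≤ n → f m n ≤ max c (K ^ κ) * ((m : ℝ) / n) ^ κ := by
  intro m n hm hmn
  have hm0 : (0 : ℝ) < m := by exact_mod_cast hm
  have hn0 : (0 : ℝ) < n := by exact_mod_cast (hm.trans hmn)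
  have hq0 : 0 < (m : ℝ) / n := div_pos hm0 hn0
  have hqκ : 0 ≤ ((m : ℝ) / n) ^ κ := (Real.rpow_pos_of_pos hq0 κ).le
  by_cases hKn : K * m ≤ n
  · exact (hb m n hm hKn).trans (mul_le_mul_of_nonneg_right (le_max_left _ _) hqκ)
  · -- bounded ratio: `n < K m`, so `K · (m/n) ≥ 1`
    push Not at hKn
    have hK0 : 0 < K := by linarith
    have h1 : 1 ≤ K * ((m : ℝ) / n) := by
      rw [mul_div_assoc', le_div_iff₀ hn0, one_mul]
      exact hKn.le
    have h2 : 1 ≤ K ^ κ * ((m : ℝ) / n) ^ κ := by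
      rw [← Real.mul_rpow hK0.le hq0.le]
      exact Real.one_le_rpow h1 hκ
    calc f m n ≤ 1 := hf1 m n
      _ ≤ K ^ κ * ((m : ℝ) / n) ^ κ := h2
      _ ≤ max c (K ^ κ) * ((m : ℝ) / n) ^ κ := mul_le_mul_of_nonneg_right (le_max_right _ _) hqκ

/-- **Garban's bound at large ratio suffices.** If, under the two-arm hypothesis of
`Garban2011_fourArm_multiscale` for some `ε > 0`, the four-arm bound `π₄(m,n) ≤ c (m/n)^{1+ε}` is
established for `1 ≤ m`, `K m ≤ n` (some `K ≥ 1`, `c > 0`), then it holds for all `1 ≤ m ≤ n`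
(with the constant `max c K^{1+ε}`). [cite: SchrammSmirnov2011, Appendix B, proof of Lemma B.1 (first paragraph)] -/
theorem fourArm_bound_of_large_ratio {ε c K : ℝ} (hε : 0 < ε) (hK : 1 ≤ K) (hc : 0 < c)
    (hb : ∀ m n : ℕ, 1 ≤ m → K * m ≤ n →
      (bondPercolation (zdGraph 2) half).real (fourArmTwoClusters m n) ≤ c * ((m : ℝ) / n) ^ (1 + ε)) :
    ∃ c' : ℝ, 0 < c' ∧ ∀ m n : ℕ, 1 ≤ m → m ≤ n →
      (bondPercolation (zdGraph 2) half).real (fourArmTwoClusters m n) ≤ c' * ((m : ℝ) / n) ^ (1 + ε) :=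
  ⟨max c (K ^ (1 + ε)), lt_max_of_lt_left hc,
    ratio_bound_of_large_ratio (f := fun m n => (bondPercolation (zdGraph 2) half).real (fourArmTwoClusters m n))
      (by linarith) hK (fun _ _ => measureReal_le_one) hb⟩

end Literature.Probability.Percolation
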